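import Summits.BirchSwinnertonDyer.BirchSwinnertonDyer.Theorems.KatoDescentPotSupersingularMemberHullRankOne
import Literature.NumberTheory.EllipticCurves.IwasawaAlgebraProofs
import Literature.NumberTheory.EllipticCurves.LeadingTerm
import Literature.NumberTheory.EllipticCurves.MordellWeilRankZeroProofs
import HarnessLib

/-!
# Route `ThetaPartnerAtTwo` (TP2), crux K3 `SignedKatoDivisibilityUpToAtTwo` (item stmt-BirchSwinnertonDyer-20308),
# line `colemanrat` v3: the FINITENESS conjunct `ℓ_𝔭(𝐇¹_Γ(T_pE)/Λs) < ⊤` of stub (C2) is PUB-reducible —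
# it follows for EVERY non-zero `s` from Gross–Zagier–Kolyvagin (`r_an ≤ 1 ⇒ rank = r_an ∧ Ш finite`, the cell's
# standing binder `hGZK`) through the tree's rank-zero (R0) theorem (lead `bsd-wall-tp2-p2x`; route-independent)

HONEST FRAMING (cell `bsd-wall`): THEOREMS ONLY — no definition, no named fact, no instance, no `sorry`; the ONE
published input is displayed as the hypothesis `h17 : rank_eq_analyticRank_of_analyticRank_le_one` (bsd.S17,
Gross–Zagier + Kolyvagin, def:Prop of `LeadingTerm.lean`); closes no item; BSD is NOT proved by any of this.

## What is proved (any prime `p`, any elliptic `W/ℚ` of analytic rank `0`)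

* `lengthAt_quotient_span_ne_top_of_gzk`: granted `h17`, for `r_an(W) = 0`, the cyclotomic `(κ, γ)`, every pinned
  `I : Kato2004.IwasawaH1Data W p κ γ`, every `s ≠ 0` in `𝐇¹_Γ(T_pW)` and every prime `𝔭` of `Λ` of height `≤ 1`:
  `ℓ_𝔭(𝐇¹_Γ(T_pW)/Λs) ≠ ⊤`. Chain (all tree theorems): `h17` ⇒ `W(ℚ)` finite (`finite_point_of_rank_zero`) and
  `Ш` finite ⇒ (R0) `rank_{ℤ_p} H¹(ℤ[1/p], T_pW) ≤ 1` (`IntegralH1RankZero.rank_integralH1_layerZero_le_one`,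
  Kato Thm. 14.5 (1)/14.13 on the pin, Euler-system-free) ⇒ `rank_Λ 𝐇¹ ≤ 1`
  (`IwasawaH1Data.rank_le_one_of_rank_integralH1_le_one`, Kato Thm. 12.4 (2) upper half) ⇒ with `𝐇¹` torsion
  free (`IwasawaH1Data.noZeroSMulDivisors`) and finitely generated (`module_finite_of_isCyclotomic`, (12.2.1)):
  `𝐇¹/Λs` is finitely generated TORSION (`MemberHullRankOne.isTorsion_quotient_span_singleton_of_rank_le_one`)
  ⇒ finite local length at every prime of height `≤ 1` (`Module.lengthAt_ne_top_of_isTorsionBy`).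
So in the registered stub (C2) `stub_colemanLengthTwo` the conjunct `lengthAt Λ (I.H ⧸ Λs) 𝔭 ≠ ⊤` carries no
`p = 2` research: it is `hGZK` + tree theorems; the research content of (C2) is the four-term inequality alone.

References: [Kato2004Asterisque] §12.2 (12.2.1) (p. 220), Thm. 12.4 (2) (p. 221), Thm. 14.5 (1) (p. 236), 14.13
(p. 243); [Darmon2004] Thm. 3.22 (Gross–Zagier–Kolyvagin); [BourbakiAC5to7] VII §4.
-/

set_option autoImplicit false
-- the Theorems namespace of this sub repeats the summit name by design (D-0017 nested layout)
set_option linter.dupNamespace false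

noncomputable section

open scoped Classical

open WeierstrassCurve Field Literature.NumberTheory.EllipticCurves Literature.NumberTheory.EllipticCurves.Module
  Literature.NumberTheory.EllipticCurves.Kato2004 Literature.NumberTheory.EllipticCurves.Kato2004.EulerSystemValues
  ZpExtension

namespace Summit.BirchSwinnertonDyer.BirchSwinnertonDyer.Theorems

namespace SignedKatoOffTwo

/-- **`ℓ_𝔭(𝐇¹_Γ(T_pW)/Λs) < ⊤` for every non-zero `s`, in analytic rank `0`, granted Gross–Zagier–Kolyvagin.**
For `W/ℚ` elliptic with `r_an(W) = 0`, any prime `p`, the cyclotomic `ℤ_p`-extension `κ` with topological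
generator `γ`, a pinned `I : IwasawaH1Data W p κ γ`, `s ∈ 𝐇¹_Γ(T_pW)` non-zero and `𝔭` a prime of `Λ` of height
`≤ 1`: `ℓ_𝔭(𝐇¹/Λs) ≠ ⊤`. `h17` (bsd.S17) gives `W(ℚ)` and `Ш(W)` finite; then (R0) `rank_{ℤ_p} H¹(ℤ[1/p],T_pW) ≤ 1`,
`rank_Λ 𝐇¹ ≤ 1`, `𝐇¹` torsion free and finitely generated (tree theorems), so `𝐇¹/Λs` is finitely generated
torsion and has finite local length at height `≤ 1`. [cite: Kato2004Asterisque, Thm. 12.4 (2) (p. 221), Thm. 14.5 (1) (p. 236) and 14.13 (p. 243)]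
[cite: Darmon2004, Thm. 3.22] -/
theorem lengthAt_quotient_span_ne_top_of_gzk (h17 : rank_eq_analyticRank_of_analyticRank_le_one)
    {W : WeierstrassCurve ℚ} [W.IsElliptic] (hr : W.analyticRank = 0) {p : ℕ} [Fact p.Prime]
    [ContinuousSMul ℤ_[p] (W.tateModule p)] {κ : ZpExtension ℚ p} {γ : absoluteGaloisGroup ℚ}
    (hκ : κ.IsCyclotomic) (hγ : κ.IsTopGenerator γ) (I : IwasawaH1Data W p κ γ) {s : I.H} (hs : s ≠ 0)
    (𝔭 : PrimeSpectrum (IwasawaAlgebra p)) (h𝔭 : 𝔭.asIdeal.height ≤ 1) :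
    lengthAt (IwasawaAlgebra p) (I.H ⧸ Submodule.span (IwasawaAlgebra p) {s}) 𝔭 ≠ ⊤ := by
  -- Gross–Zagier–Kolyvagin in analytic rank `0`: `W(ℚ)` and `Ш(W)` are finite
  obtain ⟨hrank, hsha⟩ := h17 W (by rw [hr]; exact zero_le_one)
  have h0 : W.mordellWeilRank = 0 := by rw [hrank, hr]
  haveI : Finite W.toAffine.Point := W.finite_point_of_rank_zero h0
  haveI : Finite W.sha := hsha
  haveI : Finite (AddCommGroup.primaryComponent W.sha p) := inferInstance
  -- (R0) and Kato Thm. 12.4 (2), upper half, on the pin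
  have hrk : Module.rank ℤ_[p] (integralH1 (tateRep W p) p (κ.layerSubgroup 0)) ≤ 1 :=
    IntegralH1RankZero.rank_integralH1_layerZero_le_one W p κ
  have hrank1 : Module.rank (IwasawaAlgebra p) I.H ≤ 1 := I.rank_le_one_of_rank_integralH1_le_one hκ hγ hrk
  haveI : Module.Finite (IwasawaAlgebra p) I.H := IwasawaH1Data.module_finite_of_isCyclotomic hκ hγ I
  haveI : NoZeroSMulDivisors (IwasawaAlgebra p) I.H := I.noZeroSMulDivisors hγ
  have htors : Module.IsTorsion (IwasawaAlgebra p) (I.H ⧸ Submodule.span (IwasawaAlgebra p) {s}) :=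
    MemberHullRankOne.isTorsion_quotient_span_singleton_of_rank_le_one p hrank1 hs
  obtain ⟨a, ha, ha0⟩ := Submodule.annihilator_top_inter_nonZeroDivisors htors
  exact lengthAt_ne_top_of_isTorsionBy (nonZeroDivisors.ne_zero ha0)
    (fun m ↦ Submodule.mem_annihilator.mp ha m Submodule.mem_top) 𝔭 h𝔭

end SignedKatoOffTwo

end Summit.BirchSwinnertonDyer.BirchSwinnertonDyer.Theorems

end
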